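import Summits.QuantumFields.BalabanUV.T4Continuum.Support.NE7BoxLandauSupAPriori
import HarnessLib

/-!
# NE7TorusLandauSupAPriori — THE A PRIORI SUP LETTER OF A TORUS LANDAU REPRESENTATIVE REDUCES TO ITS ZERO MODE: for a `P`-periodic `A` with `‖A‖ ≤ ρ`, plaquettes of
# `e^{A}` within `ε` of `1` and the lattice Landau condition `div sinh A = 0` at every site, EVERY component oscillates by at most
# `32d²P·(d(ε + 4ρ(e^{4ρ} − 1)) + 2d·ρ(e^{ρ} − 1))` over the whole torus — hence `‖A(x)_ν‖ ≤ ‖A(x₀)_ν‖ + (that)` for any reference bond: the sup currency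
# `a₀` of row NE7's crux (F6∕F7) is the ZERO MODE of the representative plus `O(P·(ε + ρ²))` — NO LOGARITHM
# (file F8 of gen 112; the torus twin of gen 93's box letter `NE7BoxLandauSupAPriori.landau_box_sup_le`)

Cell `pub-balaban`, rung (B)+1 sub-cell t4, lineage `b2b-balaban-t4-ne7-p1` (CRUX PROVER NE7 #1 = OWNER of BINDER row NE7), generation 112.  Memo
`t4/b2b-balaban-t4-ne7-p1-g112/ROAD-G112.md` §4.  BY NAME over gen 93's F309a `NE7TorusSupFromCurlDiv.osc_le_of_curl_div` (the torus oscillation letter from curl and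
divergence, R37's gradient half — no logarithm), F309b `NE7BoxLandauSupAPriori.norm_plaq_linear_le` (the linear curl from the plaquette of `e^{A}`), and (158b)
`NE7GradientCurrencyLandauEL.norm_sinhRem_sub_sinhRem_le` (`sinh − id` is `(e^ρ − 1)`-Lipschitz, for the divergence from the Euler–Lagrange condition).
WHY (the crux of F6∕F7 located).  F7 `NE7AllMinimisersLandauReg910` displays ONE letter: the sup currency `‖A₀‖ ≤ c₀ε∕M` of the torus Landau representative of a constrained
minimiser (torus period `P = N·M`, plaquettes `ε_p = ε∕M²`).  THIS FILE shows what that letter consists of: GIVEN an a priori radius `ρ` (the Gribov∕existence-within-radius half,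
cf. gen 93's incremental minimisation on a box), the OSCILLATION of `A₀` is `≤ 32d³P(ε_p + 36ρ²)` (`ρ ≤ 1∕4`) `= 32d³N(ε∕M + 36Mρ²)`, so in the bootstrap regime `2304d³NMρ ≤ 1`
the sup currency is `≤ 2·(zero mode) + 64d³N·ε∕M` — print's shape `c₀ε∕M` EXACTLY WHEN the zero mode `‖A₀(x₀)‖` (the evenly spread torus holonomy of the representative, a
datum of the ORBIT, invisible to the plaquettes) is itself `O(ε∕M)`.  For data with non-trivial torus holonomy the zero mode is `≍ |log hol|∕(NM)` and the bootstrap radius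
`ρ ≲ 1∕(NM)` is of the same order: the torus route to [Balaban1985Variational] (9)∕(10) is confined to the small-holonomy sector — the reason print works on cubes `□`.
WHAT ([folklore]; 0 def, 0 sorry; every `d ≥ 1`, `U(n) ⊂ M_n(ℂ)`).  `norm_div_le_of_sinh_EL` (`‖div A(y)‖ ≤ 2d·ρ(e^ρ − 1)` from the `sinh`-Landau condition), **`torus_landau_osc_le`**,
**`torus_landau_sup_le`** (`‖A(x)_ν‖ ≤ ‖A(x₀)_ν‖ + 32d²P(d(ε + 4ρ(e^{4ρ}−1)) + 2dρ(e^ρ−1))`), `torus_landau_sup_le'` (`ρ ≤ 1∕4`: `≤ ‖A(x₀)_ν‖ + 32d³P(ε + 36ρ²)`).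
HONEST FRAMING (page 1): lattice analysis for ARBITRARY periodic bond fields; the a priori radius `ρ` and the zero mode are HYPOTHESES∕data; the existence of a torus Landau
representative inside the radius is NOT proved; nothing of Bałaban's asserted; nothing about minimisers; NOT NE3∕NE7 as spine nodes; spine 0∕9; finite T⁴ rung (B)+1 — NOT
infinite volume, NOT mass gap, NOT BetaPertH, NOT Clay (continuum YM on T⁴ ⇐ BetaPertH ∧ nine spine estimates).
-/

set_option autoImplicit false

open NormedSpace
open scoped BigOperators Matrix Matrix.Norms.L2Operator
open Finset

namespace Summit.QuantumFields.BalabanUV.T4Continuum.NE7TorusLandauSupAPriori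

open Literature.MathematicalPhysics.QuantumFieldTheory.Balaban1983to89
open B7Prop1Explicit
open NE7TorusSupFromCurlDiv (osc_le_of_curl_div)
open NE7BoxLandauSupAPriori (norm_plaq_linear_le)
open NE7GradientCurrencyLandauEL (norm_sinhRem_sub_sinhRem_le)

noncomputable section

variable {d : ℕ} {n : Type*} [Fintype n] [DecidableEq n] [Nonempty n]

/-! ## §1 The divergence from the `sinh`-Landau condition -/

/-- **IN A LATTICE LANDAU GAUGE THE DIVERGENCE OF `A` IS QUADRATICALLY SMALL**: if `‖A‖ ≤ ρ` and `Σ_κ [sinh A(y)_κ − sinh A(y − e_κ)_κ] = 0` (`sinh X = (e^X − e^{−X})∕2`),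
then `‖Σ_κ [A(y)_κ − A(y − e_κ)_κ]‖ ≤ 2d·ρ(e^ρ − 1)` ((158b)'s `sinh − id` letter at `Y = 0`; cf. (162)'s `norm_flatDiv_le_of_sinhReaction_eq_zero`). [folklore] -/
theorem norm_div_le_of_sinh_EL (A : Site d → Fin d → Matrix n n ℂ) {ρ : ℝ} (hA : ∀ (y : Site d) (κ : Fin d), ‖A y κ‖ ≤ ρ) (y : Site d)
    (h : ∑ κ : Fin d, (((2 : ℂ)⁻¹ • (exp (A y κ) - exp (-A y κ))) - ((2 : ℂ)⁻¹ • (exp (A (y - e κ) κ) - exp (-A (y - e κ) κ)))) = 0) :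
    ‖∑ κ : Fin d, (A y κ - A (y - e κ) κ)‖ ≤ 2 * d * (ρ * (Real.exp ρ - 1)) := by
  have hrem : ∀ (z : Site d) (κ : Fin d), ‖((2 : ℂ)⁻¹ • (exp (A z κ) - exp (-A z κ)) - A z κ)‖ ≤ ρ * (Real.exp ρ - 1) := by
    intro z κ
    have hρ : 0 ≤ ρ := (norm_nonneg _).trans (hA z κ)
    have h0 : ‖(0 : Matrix n n ℂ)‖ ≤ ρ := by rw [norm_zero]; exact hρ
    have h1 := norm_sinhRem_sub_sinhRem_le (X := A z κ) (Y := (0 : Matrix n n ℂ)) (ρ := ρ) (hA z κ) h0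
    simp only [neg_zero, exp_zero, sub_self, smul_zero, sub_zero] at h1
    calc _ ≤ (Real.exp ρ - 1) * ‖A z κ‖ := h1
      _ ≤ (Real.exp ρ - 1) * ρ := mul_le_mul_of_nonneg_left (hA z κ) (by linarith [Real.add_one_le_exp ρ])
      _ = ρ * (Real.exp ρ - 1) := mul_comm _ _
  have hid : ∑ κ : Fin d, (A y κ - A (y - e κ) κ)
      = ∑ κ : Fin d, ((A y κ - ((2 : ℂ)⁻¹ • (exp (A y κ) - exp (-A y κ))))
          - (A (y - e κ) κ - ((2 : ℂ)⁻¹ • (exp (A (y - e κ) κ) - exp (-A (y - e κ) κ)))))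
        + ∑ κ : Fin d, (((2 : ℂ)⁻¹ • (exp (A y κ) - exp (-A y κ))) - ((2 : ℂ)⁻¹ • (exp (A (y - e κ) κ) - exp (-A (y - e κ) κ)))) := by
    rw [← Finset.sum_add_distrib]
    exact Finset.sum_congr rfl fun κ _ => by abel
  rw [hid, h, add_zero]
  calc ‖∑ κ : Fin d, ((A y κ - ((2 : ℂ)⁻¹ • (exp (A y κ) - exp (-A y κ))))
          - (A (y - e κ) κ - ((2 : ℂ)⁻¹ • (exp (A (y - e κ) κ) - exp (-A (y - e κ) κ)))))‖
      ≤ ∑ κ : Fin d, (ρ * (Real.exp ρ - 1) + ρ * (Real.exp ρ - 1)) := by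
        refine norm_sum_le_of_le _ fun κ _ => (norm_sub_le _ _).trans (add_le_add ?_ ?_)
        · rw [norm_sub_rev]; exact hrem y κ
        · rw [norm_sub_rev]; exact hrem (y - e κ) κ
    _ = 2 * d * (ρ * (Real.exp ρ - 1)) := by
        rw [Finset.sum_const, Finset.card_univ, Fintype.card_fin, nsmul_eq_mul]; ring

/-! ## §2 The oscillation and the sup letter on the torus -/

/-- **THE OSCILLATION OF A TORUS LANDAU REPRESENTATIVE — NO LOGARITHM.**  For `d ≥ 1`, `P ≥ 1`, a `P`-periodic bond field `A` with `‖A‖ ≤ ρ`, plaquettes of `e^{A}`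
within `ε` of `1` (`‖e^{A(q)_μ}e^{A(q+e_μ)_ν}e^{−A(q+e_ν)_μ}e^{−A(q)_ν} − 1‖ ≤ ε`, `μ ≠ ν`) and the `sinh`-Landau condition at every site:
`‖A(x)_ν − A(x′)_ν‖ ≤ 2·16d²P·(d·(ε + 4ρ(e^{4ρ} − 1)) + 2d·ρ(e^ρ − 1))` for ALL `x, x′, ν`. [folklore] -/
theorem torus_landau_osc_le (hd : 1 ≤ d) {P : ℕ} (hP : 1 ≤ P) (A : Site d → Fin d → Matrix n n ℂ)
    (hAP : ∀ (x : Site d) (τ μ : Fin d), A (x + (P : ℤ) • e τ) μ = A x μ) {ρ ε : ℝ} (hε : 0 ≤ ε)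
    (hA : ∀ (y : Site d) (κ : Fin d), ‖A y κ‖ ≤ ρ)
    (hplaq : ∀ (q : Site d) (μ ν : Fin d), μ ≠ ν → ‖exp (A q μ) * exp (A (q + e μ) ν) * exp (-A (q + e ν) μ) * exp (-A q ν) - 1‖ ≤ ε)
    (hEL : ∀ y : Site d,
      ∑ κ : Fin d, (((2 : ℂ)⁻¹ • (exp (A y κ) - exp (-A y κ))) - ((2 : ℂ)⁻¹ • (exp (A (y - e κ) κ) - exp (-A (y - e κ) κ)))) = 0)
    (x x' : Site d) (ν : Fin d) :
    ‖A x ν - A x' ν‖ ≤ 2 * (16 * (d : ℝ) ^ 2 * P * ((d : ℝ) * (ε + 4 * ρ * (Real.exp (4 * ρ) - 1)) + 2 * d * (ρ * (Real.exp ρ - 1)))) := by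
  have hρ : 0 ≤ ρ := (norm_nonneg _).trans (hA x ν)
  have he4 : 0 ≤ Real.exp (4 * ρ) - 1 := by linarith [Real.add_one_le_exp (4 * ρ)]
  -- the linear curl from the plaquette (trivial on the diagonal)
  have hCc : ∀ (q : Site d) (μ κ : Fin d), ‖A q μ + A (q + e μ) κ - A (q + e κ) μ - A q κ‖ ≤ ε + 4 * ρ * (Real.exp (4 * ρ) - 1) := by
    intro q μ κ
    by_cases hμκ : μ = κ
    · subst hμκ
      rw [show A q μ + A (q + e μ) μ - A (q + e μ) μ - A q μ = 0 by abel, norm_zero]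
      positivity
    · exact norm_plaq_linear_le (hA q μ) (hA (q + e μ) κ) (hA (q + e κ) μ) (hA q κ) (hplaq q μ κ hμκ)
  -- the divergence from the Euler–Lagrange condition
  have hCd : ∀ y : Site d, ‖∑ κ, (A y κ - A (y - e κ) κ)‖ ≤ 2 * d * (ρ * (Real.exp ρ - 1)) :=
    fun y => norm_div_le_of_sinh_EL A hA y (hEL y)
  exact osc_le_of_curl_div hd hP A hAP hCc hCd x x' ν

/-- **THE SUP LETTER REDUCES TO THE ZERO MODE**: under the same hypotheses, for any reference site `x₀`,
`‖A(x)_ν‖ ≤ ‖A(x₀)_ν‖ + 2·16d²P·(d·(ε + 4ρ(e^{4ρ} − 1)) + 2d·ρ(e^ρ − 1))`. [folklore] -/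
theorem torus_landau_sup_le (hd : 1 ≤ d) {P : ℕ} (hP : 1 ≤ P) (A : Site d → Fin d → Matrix n n ℂ)
    (hAP : ∀ (x : Site d) (τ μ : Fin d), A (x + (P : ℤ) • e τ) μ = A x μ) {ρ ε : ℝ} (hε : 0 ≤ ε)
    (hA : ∀ (y : Site d) (κ : Fin d), ‖A y κ‖ ≤ ρ)
    (hplaq : ∀ (q : Site d) (μ ν : Fin d), μ ≠ ν → ‖exp (A q μ) * exp (A (q + e μ) ν) * exp (-A (q + e ν) μ) * exp (-A q ν) - 1‖ ≤ ε)
    (hEL : ∀ y : Site d,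
      ∑ κ : Fin d, (((2 : ℂ)⁻¹ • (exp (A y κ) - exp (-A y κ))) - ((2 : ℂ)⁻¹ • (exp (A (y - e κ) κ) - exp (-A (y - e κ) κ)))) = 0)
    (x₀ x : Site d) (ν : Fin d) :
    ‖A x ν‖ ≤ ‖A x₀ ν‖ + 2 * (16 * (d : ℝ) ^ 2 * P * ((d : ℝ) * (ε + 4 * ρ * (Real.exp (4 * ρ) - 1)) + 2 * d * (ρ * (Real.exp ρ - 1)))) := by
  have h := torus_landau_osc_le hd hP A hAP hε hA hplaq hEL x x₀ ν
  calc ‖A x ν‖ = ‖A x₀ ν + (A x ν - A x₀ ν)‖ := by rw [add_sub_cancel]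
    _ ≤ ‖A x₀ ν‖ + ‖A x ν - A x₀ ν‖ := norm_add_le _ _
    _ ≤ _ := add_le_add le_rfl h

/-- **THE SUP LETTER, QUADRATIC FORM** (`ρ ≤ 1∕4`): `‖A(x)_ν‖ ≤ ‖A(x₀)_ν‖ + 32d³P·(ε + 36ρ²)` (`e^{4ρ} − 1 ≤ 8ρ·…`: as gen 93's `landau_box_sup_le'`, `4ρ(e^{4ρ}−1) + 2ρ(e^ρ−1) ≤ 36ρ²`;
and `d² ≤ d³`, `d·36 ≤ …` bookkeeping).  Bootstrap reading: with `P = N·M`, `ε = ε_p = r∕M²`: if `‖A‖ ≤ ρ` with `2304d³NMρ ≤ 1` then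
`‖A‖ ≤ ‖A(x₀)‖ + 32d³N·r∕M + ρ∕2`. [folklore] -/
theorem torus_landau_sup_le' (hd : 1 ≤ d) {P : ℕ} (hP : 1 ≤ P) (A : Site d → Fin d → Matrix n n ℂ)
    (hAP : ∀ (x : Site d) (τ μ : Fin d), A (x + (P : ℤ) • e τ) μ = A x μ) {ρ ε : ℝ} (hε : 0 ≤ ε) (hρ4 : ρ ≤ 1 / 4)
    (hA : ∀ (y : Site d) (κ : Fin d), ‖A y κ‖ ≤ ρ)
    (hplaq : ∀ (q : Site d) (μ ν : Fin d), μ ≠ ν → ‖exp (A q μ) * exp (A (q + e μ) ν) * exp (-A (q + e ν) μ) * exp (-A q ν) - 1‖ ≤ ε)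
    (hEL : ∀ y : Site d,
      ∑ κ : Fin d, (((2 : ℂ)⁻¹ • (exp (A y κ) - exp (-A y κ))) - ((2 : ℂ)⁻¹ • (exp (A (y - e κ) κ) - exp (-A (y - e κ) κ)))) = 0)
    (x₀ x : Site d) (ν : Fin d) :
    ‖A x ν‖ ≤ ‖A x₀ ν‖ + 32 * (d : ℝ) ^ 3 * P * (ε + 36 * ρ ^ 2) := by
  have hρ : 0 ≤ ρ := (norm_nonneg _).trans (hA x ν)
  have h := torus_landau_sup_le hd hP A hAP hε hA hplaq hEL x₀ x ν
  have hd1 : (1 : ℝ) ≤ d := by exact_mod_cast hd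
  have hP0 : (0 : ℝ) ≤ P := Nat.cast_nonneg P
  -- `e^{4ρ} − 1 ≤ 8ρ` and `e^ρ − 1 ≤ 2ρ` on `ρ ≤ 1/4`
  have hexp : ∀ t : ℝ, 0 ≤ t → t ≤ 1 → Real.exp t - 1 ≤ 2 * t := fun t h0 h1 => by
    have h' := Real.abs_exp_sub_one_le (x := t) (by rw [abs_of_nonneg h0]; exact h1)
    rw [abs_of_nonneg h0] at h'
    exact (le_abs_self _).trans h'
  have he4 : Real.exp (4 * ρ) - 1 ≤ 2 * (4 * ρ) := hexp (4 * ρ) (by positivity) (by linarith)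
  have he1 : Real.exp ρ - 1 ≤ 2 * ρ := hexp ρ hρ (by linarith)
  have hin : (d : ℝ) * (ε + 4 * ρ * (Real.exp (4 * ρ) - 1)) + 2 * d * (ρ * (Real.exp ρ - 1)) ≤ d * (ε + 36 * ρ ^ 2) := by
    have t1 : 4 * ρ * (Real.exp (4 * ρ) - 1) ≤ 32 * ρ ^ 2 := by nlinarith
    have t2 : ρ * (Real.exp ρ - 1) ≤ 2 * ρ ^ 2 := by nlinarith
    nlinarith
  have hstep : 2 * (16 * (d : ℝ) ^ 2 * P * ((d : ℝ) * (ε + 4 * ρ * (Real.exp (4 * ρ) - 1)) + 2 * d * (ρ * (Real.exp ρ - 1))))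
      ≤ 32 * (d : ℝ) ^ 3 * P * (ε + 36 * ρ ^ 2) := by
    have h1 : 2 * (16 * (d : ℝ) ^ 2 * P * ((d : ℝ) * (ε + 4 * ρ * (Real.exp (4 * ρ) - 1)) + 2 * d * (ρ * (Real.exp ρ - 1))))
        ≤ 2 * (16 * (d : ℝ) ^ 2 * P * (d * (ε + 36 * ρ ^ 2))) :=
      mul_le_mul_of_nonneg_left (mul_le_mul_of_nonneg_left hin (by positivity)) (by norm_num)
    have h2 : 2 * (16 * (d : ℝ) ^ 2 * P * (d * (ε + 36 * ρ ^ 2))) = 32 * (d : ℝ) ^ 3 * P * (ε + 36 * ρ ^ 2) := by ring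
    linarith
  linarith

end

end Summit.QuantumFields.BalabanUV.T4Continuum.NE7TorusLandauSupAPriori
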